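import Literature.AlgebraicGeometry.Resolution.FormalFibresRegularDerivations
import HarnessLib

/-!
# Climbing a finite field extension in `– ⊗_R T`: the tower argument of Stacks 07PR, generically

Topic: `Literature/AlgebraicGeometry/Resolution`. `FormalFibresRegularDerivations.lean` proves, for
a complete regular local ring `R`, a prime `𝔮`, `Ŝ = (R_𝔮)^`, `K = Frac R` and a finite
extension `L/K`, that `L ⊗_R Ŝ` is a regular ring, by climbing from `K` to the separable closure
`K_s` of `K` in `L` (one separable step) and from `K_s` to `L` by radical steps `F ⊂ F(a^{1/pⁿ})`
(The Stacks Project, Tag 07PR, proof: "We will show by induction on `[L : M]` … Let `K ⊂ M ⊂ L`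
be a subfield such that `L` is a degree `p` extension of `M` obtained by adjoining a `p`th root of
an element `f ∈ M` … Hence `A_𝔭^∧ ⊗_A L` is regular by Lemma 15.49.4 [07PG] and we win"), the
radical step being fed by a derivation `𝔇` of `F ⊗_R Ŝ` with `𝔇(a)` a unit. The induction itself
uses nothing about `Ŝ`. This file records it for an ARBITRARY `R`-algebra `T` in place of `Ŝ`,
with the derivations of the radical steps as a hypothesis — the form needed for the polynomial
version of 07PR (`T = (R[x]_Q)^`, Grothendieck's theorem 07PV on G-rings). Everything is PROVED
(the proofs are those of `FormalFibresRegularDerivations.lean`, verbatim up to the abstraction);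
no new notions, no named facts.

## Content (namespace `Literature.AlgebraicGeometry.Resolution`)

* `isRegularRing_separableClosure_tensor_of_base` — `K ⊗_R T` regular ⇒ `K_s ⊗_R T` regular.
* `isRegularRing_top_tensor_of_le_of_derivations` — the radical steps, given the derivations.
* `isRegularRing_tensor_of_derivations` — `K ⊗_R T` regular and derivations for all radical
  steps ⇒ `L ⊗_R T` regular.

## Sources

* The Stacks Project, Tag 07PR (Lemma 15.51.5), proof; Tags 07PF, 07PG (Lemmas 15.49.2, 15.49.4).
  [StacksProject]
* H. Matsumura, *Commutative Ring Theory*, CUP 1986, proof of Thm. 32.3, pp. 258–259 ("Hence if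
  `char K = 0`, there is nothing to prove. We assume that `char K = p` in what follows").
  [Matsumura1987]
-/

noncomputable section

namespace Literature.AlgebraicGeometry.Resolution

universe u

open IsLocalRing TensorProduct IntermediateField

section Tower

variable (R : Type u) [CommRing R] (K : Type u) [Field K] [Algebra R K]
  (L : Type u) [Field L] [Algebra K L] [FiniteDimensional K L] [Algebra R L] [IsScalarTower R K L]
  (T : Type u) [CommRing T] [Algebra R T]

include K in
/-- **The separable step, generically** (Stacks 07PR / Matsumura p. 258 "nothing to prove"): if
`K ⊗_R T` is a regular ring then so is `K_s ⊗_R T` for the separable closure `K_s` of `K` in the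
finite extension `L` (`K_s = K(θ)`, primitive element; separable simple step, Stacks 07PF).
[cite: StacksProject, Tag 07PR (proof)] -/
theorem isRegularRing_separableClosure_tensor_of_base [IsRegularRing (K ⊗[R] T)] :
    IsRegularRing (separableClosure K L ⊗[R] T) := by
  obtain ⟨θ, hθ⟩ := Field.exists_primitive_element K (separableClosure K L)
  exact isRegularRing_tensor_of_isSeparable (R := R) (T := T) (F := K)
    (Algebra.IsSeparable.isSeparable K θ) hθ

include K in
/-- **The radical steps, generically** (Stacks 07PR: induction on `[L : M]` over the purely
inseparable part): suppose that for every intermediate field `F` of `L/K` and every `a ∈ F ∖ F^p`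
the ring `F ⊗_R T` carries a derivation `𝔇` with `𝔇(a)` a unit. If `F ⊗_R T` is a regular ring
for an intermediate field `F ⊇ K_s` (so that `L/F` is purely inseparable), then so is `L ⊗_R T`
(`L` as the top intermediate field). Induction on `[L : F]`: pick `x ∈ L ∖ F`; its minimal
polynomial is `z^{pⁿ} - a` with `a ∈ F ∖ F^p`; the radical simple step (Stacks 07PG,
`isRegularRing_tensor_of_minpoly_eq_X_pow_sub_C`) shows `F(x) ⊗_R T` regular.
[cite: StacksProject, Tag 07PR (proof)] -/
theorem isRegularRing_top_tensor_of_le_of_derivations (p : ℕ) [Fact p.Prime] [CharP K p]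
    (hrad : ∀ (F : IntermediateField K L) (a : F), (∀ c : F, c ^ p ≠ a) →
      ∃ 𝔇 : Derivation ℤ (F ⊗[R] T) (F ⊗[R] T), IsUnit (𝔇 (algebraMap F (F ⊗[R] T) a)))
    (Ks : IntermediateField K L) [IsPurelyInseparable Ks L] :
    ∀ (n : ℕ) (F : IntermediateField K L), Ks ≤ F → Module.finrank F L = n →
      IsRegularRing (F ⊗[R] T) →
        IsRegularRing ((⊤ : IntermediateField K L) ⊗[R] T) := by
  have hp : p.Prime := Fact.out
  haveI : CharP L p := charP_of_injective_algebraMap (algebraMap K L).injective p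
  intro n
  induction n using Nat.strong_induction_on with
  | _ n ih =>
    intro F hKs hn hF
    by_cases hFtop : F = ⊤
    · subst hFtop
      exact hF
    -- an element `x ∉ F`; `L/F` is purely inseparable
    obtain ⟨x, -, hxF⟩ := SetLike.exists_of_lt (lt_top_iff_ne_top.mpr hFtop)
    haveI : CharP F p := (algebraMap F L).charP (algebraMap F L).injective p
    haveI : IsPurelyInseparable F L := by
      refine (isPurelyInseparable_iff_pow_mem F p).mpr fun y => ?_
      obtain ⟨m, k, hk⟩ := IsPurelyInseparable.pow_mem Ks p y
      exact ⟨m, ⟨(k : L), hKs k.2⟩, hk⟩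
    -- minimal polynomial `z^{p^m} - a`
    obtain ⟨m, a, hmin⟩ := IsPurelyInseparable.minpoly_eq_X_pow_sub_C F p x
    have hxint : IsIntegral F x := IsIntegral.of_finite F x
    -- `a` is not a `p`-th power in `F`
    have hm : m ≠ 0 := by
      rintro rfl
      apply hxF
      have hdeg : (minpoly F x).natDegree = 1 := by
        rw [hmin, pow_zero, pow_one, Polynomial.natDegree_X_sub_C]
      obtain ⟨y, hy⟩ := minpoly.natDegree_eq_one_iff.mp hdeg
      rw [← hy]
      exact y.2
    have ha : ∀ c : F, c ^ p ≠ a := fun c =>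
      pow_ne_of_irreducible_X_pow_sub_C (hmin ▸ minpoly.irreducible hxint)
        (dvd_pow_self p hm) hp.one_lt.ne' c
    -- the derivation on `F ⊗ T` and the radical simple step
    obtain ⟨𝔇, h𝔇⟩ := hrad F a ha
    haveI := hF
    haveI : IsScalarTower R F L := IsScalarTower.of_algebraMap_eq fun r => rfl
    haveI : FiniteDimensional F (IntermediateField.adjoin F {x}) :=
      IntermediateField.adjoin.finiteDimensional hxint
    have hF' : IsRegularRing (IntermediateField.adjoin F {x} ⊗[R] T) :=
      isRegularRing_tensor_of_minpoly_eq_X_pow_sub_C (R := R) (T := T)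
        (F := F) (θ := IntermediateField.AdjoinSimple.gen F x) (IsIntegral.of_finite F _)
        (adjoin_adjoinSimpleGen_eq_top hxint) (by rw [IntermediateField.minpoly_gen, hmin]) 𝔇 h𝔇
    -- induction hypothesis for `F' = F(x)`
    let F' : IntermediateField K L := (IntermediateField.adjoin F {x}).restrictScalars K
    have hFF' : F ≤ F' := fun y hy => (IntermediateField.adjoin F {x}).algebraMap_mem ⟨y, hy⟩
    have hdeg : Module.finrank F (IntermediateField.adjoin F {x}) = p ^ m := by
      rw [IntermediateField.adjoin.finrank hxint, hmin, Polynomial.natDegree_X_pow_sub_C]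
    have hmul := Module.finrank_mul_finrank F (IntermediateField.adjoin F {x}) L
    have hpos : 0 < Module.finrank (IntermediateField.adjoin F {x}) L := Module.finrank_pos
    have hlt : Module.finrank F' L < n := by
      change Module.finrank (IntermediateField.adjoin F {x}) L < n
      rw [← hn, ← hmul, hdeg]
      have h2 : 2 ≤ p ^ m := by
        calc 2 ≤ p := hp.two_le
          _ = p ^ 1 := (pow_one p).symm
          _ ≤ p ^ m := Nat.pow_le_pow_right hp.pos (Nat.one_le_iff_ne_zero.mpr hm)
      nlinarith
    exact ih _ hlt F' (hKs.trans hFF') rfl hF'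

include K in
/-- **`L ⊗_R T` is a regular ring**, for a finite extension `L/K`, an `R`-algebra structure on
`K`, `K ⊗_R T` regular, and derivations for all radical steps over intermediate fields (in every
prime characteristic of `K`): in characteristic `0`, `L = K_s`; in characteristic `p`, climb from
`K_s` to `L` (Stacks 07PR, proof). [cite: StacksProject, Tag 07PR (proof)] -/
theorem isRegularRing_tensor_of_derivations [IsRegularRing (K ⊗[R] T)]
    (hrad : ∀ (p : ℕ) [Fact p.Prime] [CharP K p] (F : IntermediateField K L) (a : F),
      (∀ c : F, c ^ p ≠ a) →
        ∃ 𝔇 : Derivation ℤ (F ⊗[R] T) (F ⊗[R] T), IsUnit (𝔇 (algebraMap F (F ⊗[R] T) a))) :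
    IsRegularRing (L ⊗[R] T) := by
  have hKs := isRegularRing_separableClosure_tensor_of_base R K L T
  obtain ⟨p, hp⟩ := CharP.exists K
  rcases CharP.char_is_prime_or_zero K p with hprime | rfl
  · haveI := Fact.mk hprime
    have htop := isRegularRing_top_tensor_of_le_of_derivations R K L T p (hrad p)
      (separableClosure K L) _ (separableClosure K L) le_rfl rfl hKs
    exact isRegularRing_tensor_of_algEquiv R
      ((IntermediateField.topEquiv (F := K) (E := L)).restrictScalars R) _
  · haveI : CharZero K := CharP.charP_to_charZero K
    haveI : Algebra.IsAlgebraic K L := Algebra.IsAlgebraic.of_finite K L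
    haveI : Algebra.IsSeparable K L := Algebra.IsAlgebraic.isSeparable_of_perfectField
    have heq : separableClosure K L = ⊤ := (separableClosure.eq_top_iff K L).mpr inferInstance
    haveI := hKs
    exact isRegularRing_tensor_of_algEquiv R
      (((IntermediateField.equivOfEq heq).trans IntermediateField.topEquiv).restrictScalars R) _

end Tower

end Literature.AlgebraicGeometry.Resolution

end
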